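import Summits.QuantumFields.YangMills.Theorems.BalabanLadderIRDefectSquaring
import HarnessLib

/-!
# Abstract purity basin — Casimir-flat members of the `[Sym]+[TM]` class never kill `AbstractBasin θ ε` (cscan ym-ir-cscan-basin64 g3 addendum)

Director-ym R403∕R406 unit `ym-ir-cscan-basin64` (refuter, explicit-unit), generation g3 (harness re-seat; the scan's verdict
«`stub_abstractBasin36 : AbstractBasin (1/2^3) (1/2^6)` SURVIVES — NO KILL» was delivered by g0∕g2 and booked by director-ym R413 ∕ №21 and is
NOT reopened here).  This file lands ONE further kernel fact behind the memo's no-go list (memo §3 F2∕F3, g2 addendum §2), closing the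
«exactly Casimir-free» corner of the design space in closed form.  It is a HELPER about the abstract class of
`DefectSquaring` (`IsAxisSymmetric`, `IsTracePositive`; `HasVolumeBounds` is not even needed) — no Theses statement is asserted or denied.

**Casimir-flatness beyond scale `s`** (hypothesis `hf` throughout): `φ(Z a b c) = −f·abc` for all sides `a,b,c ≥ s`, i.e. the top
eigenvalue of EVERY cross-section with sides `≥ s` lies on one volume law `λ₀ = e^{−f·abc}` (box-independent vacuum-energy density, zero
Casimir energy at those scales; e.g. products∕sums of commuting designs at a common vacuum rate, the `e^{−κV}(1 + G)` families of memo rows 7∕9∕12).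

* `one_add_exc_eq` — then `W(a,b,c,d) := Z(a,b,c,d)·e^{f·abcd} = 1 + x_d(Z a b c)` (`x = exc`, the thermal excess), so by `[Sym]` the excess is a
  symmetric function of the four sides (`exc_swap01∕02∕03`) and by `[TM]` (`exc_antitone`) it is **coordinatewise non-increasing**
  (`exc_mono`): enlarging ANY side of a Casimir-flat box can only purify it.
* `exc_cube_antitone` — in particular the cube excess `x_{⌊L/4⌋}(Z L L L)` is non-increasing in `L ≥ L₀` as soon as `s ≤ ⌊L₀/4⌋`:
  purity never degrades along the cubes (no hypothesis on the defect at all).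
* `eventually_pure` ∕ `no_kill` — if moreover `boxDefect Z L₀ ≤ θ` for some `θ < 1/2` (`L₀ ≥ 8`, `s ≤ ⌊L₀/4⌋`), then `x_{t₀} ≤ 2θ < 1`
  (`defect_facts`), iterated squaring `x_{2t} ≤ x_t²` inside the ONE box `L₀³` drives `x_d(Z L₀³) ≤ (2θ)^{2ⁿ} ≤ ε/2` at some time `d`, and
  monotonicity transports it to every cube `L ≥ max(L₀, 4d)`: `boxDefect Z L ≤ 2·x_{⌊L/4⌋}(Z L³) ≤ ε`.  So `δ(L) → 0` along ALL large `L`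
  and the `AbstractBasin θ ε` conclusion `∃ L' ≥ 8, boxDefect Z L' ≤ ε` holds for EVERY `θ < 1/2`, `ε > 0` on this subclass — far beyond the
  rungs `2⁻⁹ … 1/8` at issue.
* `not_flat_of_kill` — contrapositive, the structural constraint on any counterexample: a family of the class with `δ(L₀) ≤ θ < 1/2` whose
  defect stays `> ε` at every scale `≥ 8` has a RUNNING vacuum-energy density at the scales `≥ s` for every `2 ≤ s ≤ ⌊L₀/4⌋` (with the
  landed `CasimirSlope.casimirSlope_nonneg`, p606938: strictly negative Casimir energy somewhere at those scales) — «a kill is hot somewhere».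

Lineage: g0 `Theorems/IR/Negative/AbstractBasinCasimirSlope.lean` (p606938), g2 `…/AbstractBasinDressedVacuumFace.lean` (p612848), memos
`pub/ym-ir/ym-ir-cscan-basin64/MEMO-cscan-abstractBasin36.md`, `MEMO-cscan-g2-addendum.md`, `MEMO-cscan-g3-addendum.md`.

HONEST FRAMING.  Nothing here proves or refutes the Yang–Mills mass gap (Clay), a lattice gap, `BalabanLadder.IR` (stmt-QuantumFields-19354) or
`stub_abstractBasin36`; IR stays 0∕1; no summit statement is proved by this seat.  Elementary structural facts of the abstract basin class,
`--supports` the crux item.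
-/

open Filter Topology

namespace Summit.QuantumFields.YangMills.Cruxes.IR.AspectBootstrap.CasimirFlat

variable {Z : ℕ → ℕ → ℕ → ℕ → ℝ} {s : ℕ} {f : ℝ}

/-- Under Casimir-flatness beyond `s`: `1 + x_{m+2}(Z a b c) = Z(a,b,c,m+2) · e^{f·abc(m+2)}` for sides `a,b,c ≥ s`. -/
theorem one_add_exc_eq (hf : ∀ a b c : ℕ, s ≤ a → s ≤ b → s ≤ c → phi (Z a b c) = -(f * ((a * b * c : ℕ) : ℝ)))
    {a b c : ℕ} (ha : s ≤ a) (hb : s ≤ b) (hc : s ≤ c) (m : ℕ) :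
    1 + exc (Z a b c) (m + 2) = Z a b c (m + 2) * Real.exp (f * ((a * b * c * (m + 2) : ℕ) : ℝ)) := by
  have hE : Real.exp (((m + 2 : ℕ) : ℝ) * phi (Z a b c)) * Real.exp (f * ((a * b * c * (m + 2) : ℕ) : ℝ)) = 1 := by
    rw [← Real.exp_add, hf a b c ha hb hc, ← Real.exp_zero]
    congr 1
    push_cast
    ring
  calc 1 + exc (Z a b c) (m + 2)
      = Real.exp (((m + 2 : ℕ) : ℝ) * phi (Z a b c)) * Real.exp (f * ((a * b * c * (m + 2) : ℕ) : ℝ)) *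
          (1 + exc (Z a b c) (m + 2)) := by rw [hE, one_mul]
    _ = Z a b c (m + 2) * Real.exp (f * ((a * b * c * (m + 2) : ℕ) : ℝ)) := by
        rw [z_eq_exp_mul (Z a b c) m]; ring

/-- `[Sym]` slots `(0 1)`: the excess is unchanged under `a ↔ b`. -/
theorem exc_swap01 (hS : IsAxisSymmetric Z)
    (hf : ∀ a b c : ℕ, s ≤ a → s ≤ b → s ≤ c → phi (Z a b c) = -(f * ((a * b * c : ℕ) : ℝ)))
    {a b c : ℕ} (ha : s ≤ a) (hb : s ≤ b) (hc : s ≤ c) (m : ℕ) :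
    exc (Z a b c) (m + 2) = exc (Z b a c) (m + 2) := by
  have h1 := one_add_exc_eq hf ha hb hc m
  have h2 := one_add_exc_eq hf hb ha hc m
  have hZ : Z a b c (m + 2) = Z b a c (m + 2) := (hS a b c (m + 2)).2.1
  have hV : (a * b * c * (m + 2) : ℕ) = b * a * c * (m + 2) := by ring
  rw [hZ, hV] at h1
  linarith

/-- `[Sym]` slots `(0 2)`: the excess is unchanged under `a ↔ c`. -/
theorem exc_swap02 (hS : IsAxisSymmetric Z)
    (hf : ∀ a b c : ℕ, s ≤ a → s ≤ b → s ≤ c → phi (Z a b c) = -(f * ((a * b * c : ℕ) : ℝ)))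
    {a b c : ℕ} (ha : s ≤ a) (hb : s ≤ b) (hc : s ≤ c) (m : ℕ) :
    exc (Z a b c) (m + 2) = exc (Z c b a) (m + 2) := by
  have h1 := one_add_exc_eq hf ha hb hc m
  have h2 := one_add_exc_eq hf hc hb ha m
  have hZ : Z a b c (m + 2) = Z c b a (m + 2) := (hS a b c (m + 2)).2.2
  have hV : (a * b * c * (m + 2) : ℕ) = c * b * a * (m + 2) := by ring
  rw [hZ, hV] at h1
  linarith

/-- `[Sym]` slots `(0 3)` (space ↔ time): `x_{m+2}(Z (k+2) b c) = x_{k+2}(Z (m+2) b c)`. -/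
theorem exc_swap03 (hS : IsAxisSymmetric Z)
    (hf : ∀ a b c : ℕ, s ≤ a → s ≤ b → s ≤ c → phi (Z a b c) = -(f * ((a * b * c : ℕ) : ℝ)))
    {k b c m : ℕ} (hk : s ≤ k + 2) (hb : s ≤ b) (hc : s ≤ c) (hm : s ≤ m + 2) :
    exc (Z (k + 2) b c) (m + 2) = exc (Z (m + 2) b c) (k + 2) := by
  have h1 := one_add_exc_eq hf hk hb hc m
  have h2 := one_add_exc_eq hf hm hb hc k
  have hZ : Z (k + 2) b c (m + 2) = Z (m + 2) b c (k + 2) := (hS (k + 2) b c (m + 2)).1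
  have hV : ((k + 2) * b * c * (m + 2) : ℕ) = (m + 2) * b * c * (k + 2) := by ring
  rw [hZ, hV] at h1
  linarith

/-- Monotonicity in slot 0: enlarging the first side lowers the excess (`[TM]` on the transposed box + `(0 3)`). -/
theorem exc_mono0 (hS : IsAxisSymmetric Z) (hT : IsTracePositive Z) (hs : 2 ≤ s)
    (hf : ∀ a b c : ℕ, s ≤ a → s ≤ b → s ≤ c → phi (Z a b c) = -(f * ((a * b * c : ℕ) : ℝ)))
    {a a' b c m : ℕ} (ha : s ≤ a) (haa' : a ≤ a') (hb : s ≤ b) (hc : s ≤ c) (hm : s ≤ m + 2) :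
    exc (Z a' b c) (m + 2) ≤ exc (Z a b c) (m + 2) := by
  obtain ⟨ka, rfl⟩ : ∃ ka, a = ka + 2 := ⟨a - 2, by omega⟩
  obtain ⟨ka', rfl⟩ : ∃ ka', a' = ka' + 2 := ⟨a' - 2, by omega⟩
  have hd : HasSpectralDatum (Z (m + 2) b c) := hT _ _ _ (by omega) (by omega) (by omega)
  rw [exc_swap03 hS hf (by omega) hb hc hm, exc_swap03 hS hf ha hb hc hm]
  exact exc_antitone hd (by omega)

/-- **Coordinatewise monotonicity of the excess** under Casimir-flatness beyond `s`: for `s ≤ a ≤ a'`, `s ≤ b ≤ b'`, `s ≤ c ≤ c'`,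
`s ≤ m+2 ≤ m'+2`: `x_{m'+2}(Z a' b' c') ≤ x_{m+2}(Z a b c)`. -/
theorem exc_mono (hS : IsAxisSymmetric Z) (hT : IsTracePositive Z) (hs : 2 ≤ s)
    (hf : ∀ a b c : ℕ, s ≤ a → s ≤ b → s ≤ c → phi (Z a b c) = -(f * ((a * b * c : ℕ) : ℝ)))
    {a a' b b' c c' m m' : ℕ} (ha : s ≤ a) (haa' : a ≤ a') (hb : s ≤ b) (hbb' : b ≤ b') (hc : s ≤ c) (hcc' : c ≤ c')
    (hm : s ≤ m + 2) (hmm' : m ≤ m') :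
    exc (Z a' b' c') (m' + 2) ≤ exc (Z a b c) (m + 2) := by
  have ha' : s ≤ a' := ha.trans haa'
  have hb' : s ≤ b' := hb.trans hbb'
  have hc' : s ≤ c' := hc.trans hcc'
  have hd' : HasSpectralDatum (Z a' b' c') := hT _ _ _ (by omega) (by omega) (by omega)
  calc exc (Z a' b' c') (m' + 2)
      ≤ exc (Z a' b' c') (m + 2) := exc_antitone hd' hmm'
    _ ≤ exc (Z a b' c') (m + 2) := exc_mono0 hS hT hs hf ha haa' hb' hc' hm
    _ = exc (Z b' a c') (m + 2) := exc_swap01 hS hf ha hb' hc' m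
    _ ≤ exc (Z b a c') (m + 2) := exc_mono0 hS hT hs hf hb hbb' ha hc' hm
    _ = exc (Z a b c') (m + 2) := exc_swap01 hS hf hb ha hc' m
    _ = exc (Z c' b a) (m + 2) := exc_swap02 hS hf ha hb hc' m
    _ ≤ exc (Z c b a) (m + 2) := exc_mono0 hS hT hs hf hc hcc' hb ha hm
    _ = exc (Z a b c) (m + 2) := exc_swap02 hS hf hc hb ha m

/-- **Purity never degrades along Casimir-flat cubes**: for `s ≤ ⌊L₀/4⌋` and `L₀ ≤ L`,
`x_{⌊L/4⌋}(Z L L L) ≤ x_{⌊L₀/4⌋}(Z L₀ L₀ L₀)` (no hypothesis on the defect). -/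
theorem exc_cube_antitone (hS : IsAxisSymmetric Z) (hT : IsTracePositive Z) (hs : 2 ≤ s)
    (hf : ∀ a b c : ℕ, s ≤ a → s ≤ b → s ≤ c → phi (Z a b c) = -(f * ((a * b * c : ℕ) : ℝ)))
    {L₀ L : ℕ} (hsL₀ : s ≤ L₀ / 4) (hL : L₀ ≤ L) :
    exc (Z L L L) (L / 4) ≤ exc (Z L₀ L₀ L₀) (L₀ / 4) := by
  obtain ⟨k₀, hk₀⟩ : ∃ k₀, L₀ / 4 = k₀ + 2 := ⟨L₀ / 4 - 2, by omega⟩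
  obtain ⟨k, hk⟩ : ∃ k, L / 4 = k + 2 := ⟨L / 4 - 2, by omega⟩
  rw [hk₀, hk]
  have hsL : s ≤ L₀ := by omega
  exact exc_mono hS hT hs hf hsL hL hsL hL hsL hL (by omega) (by omega)

/-- Iterated squaring inside ONE box: `x_{k₀+2} ≤ x₀ ⇒ ∀ n, ∃ m ≥ k₀, x_{m+2} ≤ x₀^{2ⁿ}` (`exc_two_mul_le_sq`). -/
theorem exc_iter_sq {z : ℕ → ℝ} (hd : HasSpectralDatum z) (k₀ : ℕ) {x₀ : ℝ} (hx : exc z (k₀ + 2) ≤ x₀) (n : ℕ) :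
    ∃ m : ℕ, k₀ ≤ m ∧ exc z (m + 2) ≤ x₀ ^ (2 ^ n) := by
  induction n with
  | zero => exact ⟨k₀, le_rfl, by rw [pow_zero, pow_one]; exact hx⟩
  | succ n ih =>
      obtain ⟨m, hkm, hxm⟩ := ih
      refine ⟨2 * m + 2, by omega, ?_⟩
      have h0 : 0 ≤ exc z (m + 2) := exc_nonneg hd m
      calc exc z (2 * m + 2 + 2) = exc z (2 * (m + 2)) := by rw [show 2 * m + 2 + 2 = 2 * (m + 2) by ring]
        _ ≤ exc z (m + 2) ^ 2 := exc_two_mul_le_sq hd m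
        _ ≤ (x₀ ^ (2 ^ n)) ^ 2 := pow_le_pow_left₀ h0 hxm 2
        _ = x₀ ^ (2 ^ (n + 1)) := by rw [← pow_mul, ← pow_succ]

/-- **Casimir-flat members are eventually pure**: `[Sym]`, `[TM]`, Casimir-flat beyond `s ≥ 2`, and ONE cube `L₀ ≥ 8` with `s ≤ ⌊L₀/4⌋` and
`boxDefect Z L₀ ≤ θ < 1/2` ⇒ `boxDefect Z L ≤ ε` for all `L` beyond some `L₁`, for every `ε > 0`.  (`HasVolumeBounds` is not used.) -/
theorem eventually_pure (hS : IsAxisSymmetric Z) (hT : IsTracePositive Z) (hs : 2 ≤ s)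
    (hf : ∀ a b c : ℕ, s ≤ a → s ≤ b → s ≤ c → phi (Z a b c) = -(f * ((a * b * c : ℕ) : ℝ)))
    {θ ε : ℝ} (hθ : θ < 1 / 2) (hε : 0 < ε) {L₀ : ℕ} (hL₀ : 8 ≤ L₀) (hsL₀ : s ≤ L₀ / 4) (hδ : boxDefect Z L₀ ≤ θ) :
    ∃ L₁ : ℕ, ∀ L : ℕ, L₁ ≤ L → boxDefect Z L ≤ ε := by
  obtain ⟨k₀, hk₀⟩ : ∃ k₀, L₀ / 4 = k₀ + 2 := ⟨L₀ / 4 - 2, by omega⟩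
  have hd₀ : HasSpectralDatum (Z L₀ L₀ L₀) := hT _ _ _ (by omega) (by omega) (by omega)
  have hδ' : 1 - Z L₀ L₀ L₀ (2 * (k₀ + 2)) / Z L₀ L₀ L₀ (k₀ + 2) ^ 2 ≤ θ := by simpa only [boxDefect, hk₀] using hδ
  have hx0 : 0 ≤ exc (Z L₀ L₀ L₀) (k₀ + 2) := exc_nonneg hd₀ k₀
  have hxθ : exc (Z L₀ L₀ L₀) (k₀ + 2) ≤ 2 * θ := (defect_facts hd₀ k₀).2.2.2 θ hθ.le hδ'
  have hx1 : exc (Z L₀ L₀ L₀) (k₀ + 2) < 1 := by linarith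
  obtain ⟨n, hn⟩ := exists_pow_lt_of_lt_one (half_pos hε) hx1
  obtain ⟨m, hkm, hxm⟩ := exc_iter_sq hd₀ k₀ le_rfl n
  have hxm' : exc (Z L₀ L₀ L₀) (m + 2) ≤ ε / 2 :=
    hxm.trans ((pow_le_pow_of_le_one hx0 hx1.le (Nat.lt_two_pow_self).le).trans hn.le)
  refine ⟨max L₀ (4 * (m + 2)), fun L hL => ?_⟩
  have hL₀L : L₀ ≤ L := le_of_max_le_left hL
  have h4 : 4 * (m + 2) ≤ L := le_of_max_le_right hL
  obtain ⟨k, hk⟩ : ∃ k, L / 4 = k + 2 := ⟨L / 4 - 2, by omega⟩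
  have hdL : HasSpectralDatum (Z L L L) := hT _ _ _ (by omega) (by omega) (by omega)
  have hsL : s ≤ L₀ := by omega
  have hmono : exc (Z L L L) (k + 2) ≤ exc (Z L₀ L₀ L₀) (m + 2) :=
    exc_mono hS hT hs hf hsL hL₀L hsL hL₀L hsL hL₀L (by omega) (by omega)
  have h3 := (defect_facts hdL k).2.2.1
  have : 1 - Z L L L (2 * (k + 2)) / Z L L L (k + 2) ^ 2 ≤ ε := by linarith
  simpa only [boxDefect, hk] using this

/-- **No kill from the Casimir-flat corner**: the `AbstractBasin θ ε` conclusion `∃ L' ≥ 8, boxDefect Z L' ≤ ε` holds for every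
`θ < 1/2`, `ε > 0` on Casimir-flat members of the class (hypotheses as in `eventually_pure`). -/
theorem no_kill (hS : IsAxisSymmetric Z) (hT : IsTracePositive Z) (hs : 2 ≤ s)
    (hf : ∀ a b c : ℕ, s ≤ a → s ≤ b → s ≤ c → phi (Z a b c) = -(f * ((a * b * c : ℕ) : ℝ)))
    {θ ε : ℝ} (hθ : θ < 1 / 2) (hε : 0 < ε) {L₀ : ℕ} (hL₀ : 8 ≤ L₀) (hsL₀ : s ≤ L₀ / 4) (hδ : boxDefect Z L₀ ≤ θ) :
    ∃ L' : ℕ, 8 ≤ L' ∧ boxDefect Z L' ≤ ε := by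
  obtain ⟨L₁, h⟩ := eventually_pure hS hT hs hf hθ hε hL₀ hsL₀ hδ
  exact ⟨max L₁ 8, le_max_right _ _, h _ (le_max_left _ _)⟩

/-- **A kill is hot somewhere** (contrapositive): a member of the class with `boxDefect Z L₀ ≤ θ < 1/2` (`L₀ ≥ 8`) whose defect exceeds
`ε` at EVERY scale `≥ 8` is NOT Casimir-flat beyond any `s` with `2 ≤ s ≤ ⌊L₀/4⌋`: its vacuum-energy density `−φ(Z a b c)/(abc)` is not
constant on the boxes with sides `≥ s` (and by `CasimirSlope.casimirSlope_nonneg` it is then non-constant monotonically: strictly negative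
Casimir energy at some such box). -/
theorem not_flat_of_kill (hS : IsAxisSymmetric Z) (hT : IsTracePositive Z) {θ ε : ℝ} (hθ : θ < 1 / 2) (hε : 0 < ε)
    {L₀ : ℕ} (hL₀ : 8 ≤ L₀) (hδ : boxDefect Z L₀ ≤ θ) (hkill : ∀ L' : ℕ, 8 ≤ L' → ε < boxDefect Z L')
    {s : ℕ} (hs : 2 ≤ s) (hsL₀ : s ≤ L₀ / 4) :
    ¬ ∃ f : ℝ, ∀ a b c : ℕ, s ≤ a → s ≤ b → s ≤ c → phi (Z a b c) = -(f * ((a * b * c : ℕ) : ℝ)) := by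
  rintro ⟨f, hf⟩
  obtain ⟨L', h8, hle⟩ := no_kill hS hT hs hf hθ hε hL₀ hsL₀ hδ
  exact absurd (hkill L' h8) (not_lt.mpr hle)

end Summit.QuantumFields.YangMills.Cruxes.IR.AspectBootstrap.CasimirFlat
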